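import Summits.Ventures.YMGap.RobustBall.SusceptibilityPoincare
import Summits.Ventures.YMGap.Thresholds.SharpStrongCouplingFree
import Summits.Ventures.YMGap.Thresholds.StarMassGapSUN
import Summits.Ventures.YMGap.Thresholds.OneLinkModulusSU3Twisted
import Literature.MathematicalPhysics.QuantumFieldTheory.Balaban1983to89.StrongCouplingKernelWindow
import HarnessLib

/-!
# Robust ball (Y2) — the explicit susceptibility bound from the heat-bath gap: the `MassGapAt` form, every `SU(N)` and `SU(3)` cells

HONEST FRAMING: venture file of the cell `pub-ymgap` (QuantumFields programme), track ROBUST-BALL, seat rb-p2 (g15); cells of `SusceptibilityPoincare.lean`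
(g15: `gibbs_susceptibility_le_of_oneLinkKRModulus`).  LATTICE statements at STRONG COUPLING, Wilson action, `d = 4` (class K); nothing about `β → ∞`, the
continuum or Clay.
* `gibbs_susceptibility_le_of_massGapAt` — `d = 4`, every `SU(N)`: the mass-gap currency `MassGapAt 4 N β` (unique DLR state + exponential clustering of gauge-
  invariant local observables) supplies translation invariance (`oneState_translationInvariant_of_massGapAt`) and absolute summability of the autocovariance
  (`isMassiveState_of_massGapAt`); a one-link KR modulus `OneLinkKRModulus N R K` with `R ≥ 6|β|`, `18|β|K ≤ c < 1` supplies the Poincaré side.  Then for the DLR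
  state `μ` and every gauge-invariant Lipschitz cylinder `F` with link-oscillation profile `δ`: `∑_v Cov_μ(F, F∘θ_v) ≤ (2(1−c))⁻¹‖δ‖₁²`.
* `suN_gibbs_susceptibility_le_bakryEmery` — EVERY `SU(N)`, `N ≥ 2`, HYPOTHESIS-FREE on 't Hooft `0 ≤ b < 1/48` (bare `Nb`; Bakry–Émery modulus `K = 1/(1/2 − 6b)`,
  `c = 18b/(1/2 − 6b)`; `MassGapAt` from p1's `massGapAt_sharp_free`, `|b| < 1/32`): `χ(F) ≤ (2(1 − 18b/(1/2 − 6b)))⁻¹‖δ‖₁²`; plaquette (`‖δ‖₁ ≤ 8`):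
  `suN_gibbs_plaquette_susceptibility_le_bakryEmery`.
* `su3_gibbs_susceptibility_le_pv2t` — `SU(3)`, HYPOTHESIS-FREE on `0 ≤ β_W ≤ 81/308` (tree coupling `β_W/3`; engine-2's twisted modulus `(1/5, 3531/2000)`,
  `c = 3531β_W/1000`; `MassGapAt` from `su3_massGapAt_le`): `χ(F) ≤ (2(1 − 3531β_W/1000))⁻¹‖δ‖₁²`.
0 sorry, 0 definitions.  Everything here is proved. [folklore]
-/

noncomputable section

open MeasureTheory Function Real Finset ProbabilityTheory Filter Topology
open scoped NNReal
open Literature.Probability.LatticeModels hiding configShift configShift_apply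
open Literature.MathematicalPhysics.QuantumLattice hiding torusNorm
open Literature.MathematicalPhysics.QuantumFieldTheory hiding ZdEdge Site IsLocalObservable
open Literature.MathematicalPhysics.QuantumFieldTheory.Balaban1983to89.StrongCouplingDobrushinWindow (OneLinkKRModulus)
open Literature.MathematicalPhysics.QuantumFieldTheory.Balaban1983to89.StrongCouplingKernelWindow (oneLinkKRModulus_SU)
open Literature.Barriers.QuantumFields (IsMassiveState)

namespace Summit.Ventures.YMGap.RobustBall.HeatBathConcentration

variable {N : ℕ}

/-- ★★ **THE `MassGapAt` FORM** (`d = 4`, every `SU(N)`, `N ≥ 1`): `MassGapAt 4 N β` and a one-link KR modulus `OneLinkKRModulus N R K` with `6|β| ≤ R`,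
`18|β|K ≤ c < 1` ⇒ for every DLR state `μ` at tree coupling `Nβ` (there is exactly one, and it is translation invariant) and every gauge-invariant Lipschitz cylinder
`F` on `Δ` with link-oscillation profile `δ ≥ 0` supported in `Δ`: `v ↦ |Cov_μ(F, F∘θ_v)|` is summable and `∑_v Cov_μ(F, F∘θ_v) ≤ (2(1−c))⁻¹ (∑_{e∈Δ} δ_e)²`. [folklore] -/
theorem gibbs_susceptibility_le_of_massGapAt (hN : 1 ≤ N) {β R K c : ℝ} (hgap : MassGapAt 4 N β) (hK : 0 ≤ K)
    (hR : |β| * (2 * (((4 : ℕ) : ℝ) - 1)) ≤ R) (hmod : OneLinkKRModulus N R K) (hc : 6 * (((4 : ℕ) : ℝ) - 1) * |β| * K ≤ c) (hc1 : c < 1)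
    {μ : Measure (LGConfig 4 (Matrix.specialUnitaryGroup (Fin N) ℂ))}
    (hμ : μ ∈ ymGibbsMeasures (d := 4) (fundamentalRep (Fin N)) (N * β))
    {F : LGConfig 4 (Matrix.specialUnitaryGroup (Fin N) ℂ) → ℝ} {Δ : Finset (ZdEdge 4)} {KF : ℝ≥0}
    (hF : IsLipschitzCylinder (fundamentalRep (Fin N)) F Δ KF) (hFg : IsZdGaugeInvariant F)
    {δ : ZdEdge 4 → ℝ} (hδ0 : ∀ e, 0 ≤ δ e) (hδΔ : ∀ e, e ∉ Δ → δ e = 0) (hδ : ∀ e U s, |F U - F (update U e s)| ≤ δ e) :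
    Summable (fun v : Site 4 => |cov[F, fun U => F (configShift v U); μ]|) ∧
      ∑' v : Site 4, cov[F, fun U => F (configShift v U); μ] ≤ (2 * (1 - c))⁻¹ * (∑ e ∈ Δ, δ e) ^ 2 := by
  obtain ⟨μ₀, hG, hinv⟩ := oneState_translationInvariant_of_massGapAt (d := 4) (N := N) hgap
  have hμeq : μ = μ₀ := by rw [hG] at hμ; exact Set.mem_singleton_iff.1 hμ
  subst hμeq
  have hμ' : IsGibbsMeasure (ymSpecification (d := 4) (fundamentalRep (Fin N)) (N * β)) μ := hμ
  haveI := hμ'.isProbabilityMeasure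
  have hmass : IsMassiveState μ := Summit.Ventures.YMGap.MassGapMassive.isMassiveState_of_massGapAt hN hgap μ hμ
  have hloc : Literature.MathematicalPhysics.QuantumLattice.IsLocalObservable F := ⟨Δ, hF.isCylinder⟩
  obtain ⟨m, hm⟩ := hmass
  obtain ⟨hm0, C, hC⟩ := hm F F hloc hloc hF.measurable hF.measurable ⟨_, hF.abs_le⟩ ⟨_, hF.abs_le⟩ hFg hFg
  have hs : Summable fun v : Site 4 => |cov[F, fun U => F (configShift v U); μ]| :=
    ThermodynamicVariance.summable_abs_of_exp_decay (d := 4) (by norm_num) hm0 hC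
  exact ⟨hs, gibbs_susceptibility_le_of_oneLinkKRModulus (d := 4) (by norm_num) hN hK hR hmod hc hc1 hμ hinv hF hδ0 hδΔ hδ hs⟩

/-- ★★ **EVERY `SU(N)`, `N ≥ 2`, `d = 4`, HYPOTHESIS-FREE on 't Hooft `0 ≤ b < 1/48`** (bare `Nb`; Bakry–Émery modulus): for the DLR state `μ` and every gauge-
invariant Lipschitz cylinder `F` with link-oscillation profile `δ`: `∑_v Cov_μ(F, F∘θ_v) ≤ (2(1 − 18b/(1/2 − 6b)))⁻¹ (∑_{e∈Δ} δ_e)²` (and the series converges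
absolutely). [folklore] -/
theorem suN_gibbs_susceptibility_le_bakryEmery (hN : 2 ≤ N) {b : ℝ} (hb0 : 0 ≤ b) (hb : b < 1 / 48)
    {μ : Measure (LGConfig 4 (Matrix.specialUnitaryGroup (Fin N) ℂ))}
    (hμ : μ ∈ ymGibbsMeasures (d := 4) (fundamentalRep (Fin N)) (N * b))
    {F : LGConfig 4 (Matrix.specialUnitaryGroup (Fin N) ℂ) → ℝ} {Δ : Finset (ZdEdge 4)} {KF : ℝ≥0}
    (hF : IsLipschitzCylinder (fundamentalRep (Fin N)) F Δ KF) (hFg : IsZdGaugeInvariant F)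
    {δ : ZdEdge 4 → ℝ} (hδ0 : ∀ e, 0 ≤ δ e) (hδΔ : ∀ e, e ∉ Δ → δ e = 0) (hδ : ∀ e U s, |F U - F (update U e s)| ≤ δ e) :
    Summable (fun v : Site 4 => |cov[F, fun U => F (configShift v U); μ]|) ∧
      ∑' v : Site 4, cov[F, fun U => F (configShift v U); μ] ≤ (2 * (1 - 18 * b / (1 / 2 - 6 * b)))⁻¹ * (∑ e ∈ Δ, δ e) ^ 2 := by
  have habs : |b| = b := abs_of_nonneg hb0
  have hden : 0 < 1 / 2 - 6 * b := by linarith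
  have hgap : MassGapAt 4 N b := by
    refine SharpUniquenessJoin.massGapAt_sharp_free (d := 4) (by norm_num) hN ?_
    rw [habs]; unfold HessianSharp.sharpThresholdSU; norm_num; linarith
  have hc1 : 18 * b / (1 / 2 - 6 * b) < 1 := by rw [div_lt_one hden]; linarith
  refine gibbs_susceptibility_le_of_massGapAt (by omega) hgap (K := 1 / (1 / 2 - 6 * b)) (div_nonneg zero_le_one hden.le) (R := 6 * b)
    (by rw [habs]; push_cast; linarith) (oneLinkKRModulus_SU hN (by linarith)) (c := 18 * b / (1 / 2 - 6 * b)) ?_ hc1 hμ hF hFg hδ0 hδΔ hδ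
  rw [habs]; push_cast
  exact le_of_eq (by field_simp; ring)

/-- ★ **EVERY `SU(N)`, `N ≥ 2`, THE PLAQUETTE** (`W_p = (1/N) Re tr U_p`, `‖δ‖₁ ≤ 8`): on `0 ≤ b < 1/48`, `∑_v Cov_μ(W_p, W_p∘θ_v) ≤ 64 · (2(1 − 18b/(1/2 − 6b)))⁻¹`.
[folklore] -/
theorem suN_gibbs_plaquette_susceptibility_le_bakryEmery (hN : 2 ≤ N) {b : ℝ} (hb0 : 0 ≤ b) (hb : b < 1 / 48)
    {μ : Measure (LGConfig 4 (Matrix.specialUnitaryGroup (Fin N) ℂ))}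
    (hμ : μ ∈ ymGibbsMeasures (d := 4) (fundamentalRep (Fin N)) (N * b)) (p : ZdPlaquette 4) :
    ∑' v : Site 4, cov[zdPlaquetteObs (d := 4) (fundamentalRep (Fin N)) p.1 p.2.1.1 p.2.1.2,
        fun U => zdPlaquetteObs (d := 4) (fundamentalRep (Fin N)) p.1 p.2.1.1 p.2.1.2 (configShift v U); μ] ≤
      64 * (2 * (1 - 18 * b / (1 / 2 - 6 * b)))⁻¹ := by
  classical
  have hL := isLipschitzCylinder_zdPlaquetteObs (N := N) (d := 4) p.1 (i := p.2.1.1) (j := p.2.1.2) p.2.2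
  set δ : ZdEdge 4 → ℝ := fun e => if e ∈ plaquetteEdges p then 2 else 0 with hδdef
  have hδ0 : ∀ e, 0 ≤ δ e := fun e => by simp only [hδdef]; split_ifs <;> norm_num
  have hδΔ : ∀ e, e ∉ plaquetteEdges p → δ e = 0 := fun e he => by simp [hδdef, he]
  have hδ : ∀ e U s, |zdPlaquetteObs (d := 4) (fundamentalRep (Fin N)) p.1 p.2.1.1 p.2.1.2 U -
      zdPlaquetteObs (d := 4) (fundamentalRep (Fin N)) p.1 p.2.1.1 p.2.1.2 (update U e s)| ≤ δ e := by
    intro e U s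
    by_cases he : e ∈ plaquetteEdges p
    · simp only [hδdef, he, if_true]
      calc _ ≤ |zdPlaquetteObs (d := 4) (fundamentalRep (Fin N)) p.1 p.2.1.1 p.2.1.2 U| +
            |zdPlaquetteObs (d := 4) (fundamentalRep (Fin N)) p.1 p.2.1.1 p.2.1.2 (update U e s)| := abs_sub _ _
        _ ≤ 1 + 1 := add_le_add (abs_plaquetteObs_le_one p U) (abs_plaquetteObs_le_one p _)
        _ = 2 := by norm_num
    · simp only [hδdef, he, if_false]
      rw [ZeroCouplingMoments.zdPlaquetteObs_update_of_not_mem (fundamentalRep (Fin N)) he U s, sub_self, abs_zero]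
  have key := suN_gibbs_susceptibility_le_bakryEmery hN hb0 hb hμ hL (isZdGaugeInvariant_zdPlaquetteObs (d := 4) (N := N) (by omega) p) hδ0 hδΔ hδ
  refine key.2.trans ?_
  have hden : 0 < 1 / 2 - 6 * b := by linarith
  have hc1 : 18 * b / (1 / 2 - 6 * b) < 1 := by rw [div_lt_one hden]; linarith
  have hA : 0 ≤ (2 * (1 - 18 * b / (1 / 2 - 6 * b)))⁻¹ := inv_nonneg.2 (by linarith)
  have hsum : ∑ e ∈ plaquetteEdges p, δ e ≤ 8 := by
    have h1 : ∑ e ∈ plaquetteEdges p, δ e = 2 * (plaquetteEdges p).card := by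
      rw [Finset.sum_congr rfl fun e (he : e ∈ plaquetteEdges p) => show δ e = 2 by simp [hδdef, he], Finset.sum_const, nsmul_eq_mul, mul_comm]
    rw [h1]
    have h2 : ((plaquetteEdges p).card : ℝ) ≤ 4 := by exact_mod_cast card_plaquetteEdges_le p
    linarith
  have hsum0 : 0 ≤ ∑ e ∈ plaquetteEdges p, δ e := Finset.sum_nonneg fun e _ => hδ0 e
  have hsq : (∑ e ∈ plaquetteEdges p, δ e) ^ 2 ≤ 64 := by nlinarith
  calc (2 * (1 - 18 * b / (1 / 2 - 6 * b)))⁻¹ * (∑ e ∈ plaquetteEdges p, δ e) ^ 2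
      ≤ (2 * (1 - 18 * b / (1 / 2 - 6 * b)))⁻¹ * 64 := mul_le_mul_of_nonneg_left hsq hA
    _ = 64 * (2 * (1 - 18 * b / (1 / 2 - 6 * b)))⁻¹ := mul_comm _ _

/-- ★★ **`SU(3)`, `d = 4`, HYPOTHESIS-FREE on `0 ≤ β_W ≤ 81/308`** (tree coupling `β_W/3`; twisted modulus `OneLinkKRModulus 3 (1/5) (3531/2000)`, `MassGapAt` from
`su3_massGapAt_le`): for the DLR state `μ` and every gauge-invariant Lipschitz cylinder `F` with link-oscillation profile `δ`:
`∑_v Cov_μ(F, F∘θ_v) ≤ (2(1 − 3531β_W/1000))⁻¹ (∑_{e∈Δ} δ_e)²`. [folklore] -/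
theorem su3_gibbs_susceptibility_le_pv2t {βW : ℝ} (h0 : 0 ≤ βW) (h : βW ≤ 81 / 308)
    {μ : Measure (LGConfig 4 (Matrix.specialUnitaryGroup (Fin 3) ℂ))}
    (hμ : μ ∈ ymGibbsMeasures (d := 4) (fundamentalRep (Fin 3)) (βW / 3))
    {F : LGConfig 4 (Matrix.specialUnitaryGroup (Fin 3) ℂ) → ℝ} {Δ : Finset (ZdEdge 4)} {KF : ℝ≥0}
    (hF : IsLipschitzCylinder (fundamentalRep (Fin 3)) F Δ KF) (hFg : IsZdGaugeInvariant F)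
    {δ : ZdEdge 4 → ℝ} (hδ0 : ∀ e, 0 ≤ δ e) (hδΔ : ∀ e, e ∉ Δ → δ e = 0) (hδ : ∀ e U s, |F U - F (update U e s)| ≤ δ e) :
    Summable (fun v : Site 4 => |cov[F, fun U => F (configShift v U); μ]|) ∧
      ∑' v : Site 4, cov[F, fun U => F (configShift v U); μ] ≤ (2 * (1 - 3531 * βW / 1000))⁻¹ * (∑ e ∈ Δ, δ e) ^ 2 := by
  have hβ : ((3 : ℕ) : ℝ) * (βW / 9) = βW / 3 := by push_cast; ring
  have habs : |βW / 9| = βW / 9 := abs_of_nonneg (by positivity)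
  have hμ9 : μ ∈ ymGibbsMeasures (d := 4) (fundamentalRep (Fin 3)) (((3 : ℕ) : ℝ) * (βW / 9)) := by rwa [hβ]
  have hgap : MassGapAt 4 3 (βW / 9) := StarSUNLimit.su3_massGapAt_le (by rw [abs_of_nonneg h0]; exact h)
  exact gibbs_susceptibility_le_of_massGapAt (by norm_num) hgap (by norm_num) (R := 1 / 5) (by rw [habs]; push_cast; linarith)
    TwistedBochner.su3_oneLinkKRModulus_pv2t_oneFifth (c := 3531 * βW / 1000) (by rw [habs]; push_cast; linarith) (by linarith) hμ9 hF hFg hδ0 hδΔ hδ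

end Summit.Ventures.YMGap.RobustBall.HeatBathConcentration

end
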